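import Literature.MathematicalPhysics.QuantumFieldTheory.Balaban1983to89.Step

/-!
# `Balaban1983to89.B14Def2ImprovedSpace` — CMP 119 §2 p. 262, the SPACE clause of the improved inductive assumptions for
# the newly created terms `E^{(k)}, R^{(k)}, B^{(k)}` (*"defined on slightly larger spaces, with the coefficients in their
# definition bigger by β multiplied by a corresponding number"*), typed AT PRINT'S PRECISION as a predicate on the abstract
# tower `Step.LFTower`, with the restriction back to `Step.LFHypImproved` / `Step.LFHyp` PROVED

statement-level skeleton of published theorems with citation tags; proofs where landed; nothing here is a claim about the Yang–Mills mass gap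

CITATION HEADER (lean-in-tree rule).  Source: T. Bałaban, *Convergent renormalization expansions for lattice gauge
theories*, Commun. Math. Phys. **119**, 243–285 (1988), doi:10.1007/bf01217741 [Balaban1988Convergent] (cell paper
B14 = «[III]»; held `paper:balaban1988-cmp119-convergent-renormalization`, journal page = PDF page + 242; p. 262 read on
the text layer `p0020` and the x2 render `…-p020-x2.png`); the instance numbers of [I] = T. Bałaban, *Renormalization
group approach to lattice gauge field theories. I*, Commun. Math. Phys. **109**, 249–301 (1987) [Balaban1987RG1] (held
`paper:balaban1987-cmp109-rg-i-small-field`, journal page = PDF page + 248; pp. 277, 280 read on the text layer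
`p0029`, `p0032`).  Mega-formalization `lit-balaban`, unit `lit-balaban-r11` (CMP 119, B14 fold owner), SKELETON row
**B14.Def§2.improved**; member asked for by the lead's HEAD WORD Q-B14-98-1 (δ) (2026-08-23).

THE PRINTED TEXT (p. 262 [PDF 20], verbatim).  *"All the inductive assumptions are formulated for the effective density
obtained after the k-th operation 𝐑T. It is a composition of the operations T and 𝐑, applied in this order, and after
the operation T we obtain expressions with better analyticity and decay properties. More precisely, the expressions
with indices j < k are exactly as described above, but the newly created expressions E^{(k)}, R^{(k)}, B^{(k)} are
defined on slightly larger spaces, with the coefficients in their definition bigger by β multiplied by a corresponding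
number, and they have better decay properties, with the number κ replaced, for example, by (1+4β)κ. Such improved bounds
are needed for the R-operation."*  The "coefficients in their definition" are the radii `α_{0,j}, α_{1,j}` (2.28) of the
analyticity spaces `U^c_j(X, α_{0,j}, α_{1,j})` ((2.27)(ii), p. 259) and `α̃₀, α̃₁` of `Ũ^c_j(X, α̃₀, α̃₁)` ((2.34)–(2.39),
(2.41)(ii)); [III] fixes no "corresponding number".  The instance in print is [I]: *"We consider functions in (3.28), or
(3.34), on the space U^c_{k+1}(□₀, (1+2β)α₀, (1+2β)α₁, α₀) of configurations U, J"* (p. 277) and Lemma 4 p. 280 *"For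
U ∈ U^c_{k+1}(□₀, (1+2β)α₀, (1+2β)α₁) … The functions in (3.53) are analytic on the above spaces"* — radii multiplied by
`1 + 2β`.

WHAT IS TYPED / PROVED (0 `sorry`, no `Prop`-valued `def`; the one new `Prop`-structure is a HYPOTHESIS PREDICATE on the
tower data, the species of `Step.LFHypImproved`, not a named fact).
§1  **`LFHypImprovedSpace T c β n₀ n₁ k SB`** — the p. 262 improved assumptions for the newest terms WITH THE SPACE CLAUSE:
    the three bounds of `Step.LFHypImproved` (decay rate `(1+4β)κ`, "for example") demanded on the ENLARGED spaces
    `U^c_k(X, (1+n₀β)α_{0,k}, (1+n₁β)α_{1,k})` (= `T.space k X ((1+n₀β)·α₀(g_k)) ((1+n₁β)·α₁(g_k))`, the "corresponding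
    numbers" `n₀, n₁` as parameters) and on an enlarged boundary-term space `SB X ⊇ Ũ^c_k(X, α̃₀, α̃₁)` (the abstract tower
    carries `Ũ^c_k` without its radii, `LFTower.spaceB`, so its enlargement enters as the datum `SB`), together with the
    inclusions "old space ⊆ slightly larger space" (`space_subset`, `spaceB_subset`) which are the content of *"larger"* on
    an abstract tower.  `instI` records the [I] numbers `n₀ = n₁ = 2`.
§2  PROVED bookkeeping: **`toImproved`** (restriction along the inclusions gives `Step.LFHypImproved T c β k` — the decay
    clause alone, as typed since the cell's first version), hence `toWeak_E/R/B` (the ordinary (2.27)(iv)/(2.31)/(2.42)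
    bounds when the index becomes old, via `Step.LFHypImproved.toWeak_*`); `iff_improved_of_zero` (zero enlargement,
    `n₀ = n₁ = 0`, `SB = Ũ^c_k`: the predicate IS `LFHypImproved` — a conservative extension); `zero` (vacuous at `k = 0`,
    as `LFHypImproved.zero`); `anti` (a larger enlargement is a stronger hypothesis, given monotonicity of the abstract
    spaces in their radii, `hmono`, and `β, α_{0,k}, α_{1,k} ≥ 0`).

NOT ASSERTED: that any tower satisfies the predicate (Theorem 1, row B14.Thm1; the producer side is [B15]/[B16]); the
values of `n₀, n₁` for [III]'s terms ([III] prints none; [I]'s `2` is recorded as `instI` only); analyticity in content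
(the spaces are abstract `Set Φ`, DIVERGENCE D-f2.1/D-f2.7 of `Step`).

## References
* [Balaban1988Convergent] T. Bałaban, Commun. Math. Phys. 119 (1988) 243–285, §2 p. 262 (and (2.27)–(2.28) p. 259,
  (2.31) p. 260, (2.34)–(2.42) p. 261).
* [Balaban1987RG1] T. Bałaban, Commun. Math. Phys. 109 (1987) 249–301, (3.28)/(3.34) p. 277, Lemma 4 p. 280.
-/

noncomputable section

namespace Literature.MathematicalPhysics.QuantumFieldTheory.Balaban1983to89.B14.Def2ImprovedSpace

open Literature.MathematicalPhysics.QuantumFieldTheory.Balaban1983to89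
open Step

variable {P : Params} {G : Type*} [GaugeGroup G] {Φ 𝒢 𝔄 : Type*}

/-! ## §1. The improved assumptions WITH the space clause -/

/-- The ENLARGED radius: a coefficient `α` of (2.28) *"bigger by β multiplied by a corresponding number"* `n`, i.e.
`(1 + nβ)·α` ([I] p. 277, Lemma 4 p. 280: `(1+2β)α₀, (1+2β)α₁`). [cite: Balaban1988Convergent, §2 p.262; Balaban1987RG1, Lemma 4 p.280] -/
def enl (n βc α : ℝ) : ℝ := (1 + n * βc) * α

/-- Zero "corresponding number": no enlargement. [cite: Balaban1988Convergent, §2 p.262] -/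
@[simp] theorem enl_zero_left (βc α : ℝ) : enl 0 βc α = α := by simp [enl]

/-- Unfolding of the enlarged radius `(1 + nβ)·α`. [cite: Balaban1988Convergent, §2 p.262; Balaban1987RG1, Lemma 4 p.280] -/
theorem enl_def (n βc α : ℝ) : enl n βc α = (1 + n * βc) * α := rfl

/-- `α ≤ (1 + nβ)α` when `n, β, α ≥ 0`: the enlarged radius is not smaller (*"slightly larger spaces"*). [cite: Balaban1988Convergent, §2 p.262] -/
theorem le_enl {n βc α : ℝ} (hn : 0 ≤ n) (hβ : 0 ≤ βc) (hα : 0 ≤ α) : α ≤ enl n βc α := by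
  unfold enl; nlinarith [mul_nonneg (mul_nonneg hn hβ) hα]

/-- Monotonicity of the enlarged radius in the "corresponding number". [cite: Balaban1988Convergent, §2 p.262] -/
theorem enl_mono {n n' βc α : ℝ} (h : n ≤ n') (hβ : 0 ≤ βc) (hα : 0 ≤ α) : enl n βc α ≤ enl n' βc α := by
  unfold enl; nlinarith [mul_nonneg hβ hα]

/-- **B14 p. 262, the improved inductive assumptions for the NEWLY CREATED terms `E^{(k)}, R^{(k)}, B^{(k)}` with the
SPACE clause** (*"defined on slightly larger spaces, with the coefficients in their definition bigger by β multiplied by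
a corresponding number, and they have better decay properties, with the number κ replaced, for example, by (1+4β)κ"*):
on the tower `T` with constants `c`, at the newest index `k`, with `β = βc`, "corresponding numbers" `n₀, n₁` for the two
radii of `U^c_k(X, α_{0,k}, α_{1,k})` and an enlarged boundary-term space `SB X ⊇ Ũ^c_k(X, α̃₀, α̃₁)`:
* `space_subset`, `spaceB_subset` — the old spaces are contained in the slightly larger ones;
* `boundE` — (2.27)(iv) with rate `(1+4β)κ` on `U^c_k(X, (1+n₀β)α_{0,k}, (1+n₁β)α_{1,k})`;
* `boundR` — (2.31) likewise;  `boundB` — (2.42) with rate `(1+4β)κ` on `SB X` (print's `<` typed `≤`, D-f2.6 of `Step`).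
[cite: Balaban1988Convergent, §2 p.262] -/
structure LFHypImprovedSpace (T : LFTower P G Φ 𝒢 𝔄) (c : LFConsts) (βc n₀ n₁ : ℝ) (k : ℕ)
    (SB : (T.sys k).Dom → Set Φ) : Prop where
  space_subset : 1 ≤ k → ∀ X, T.space k X (c.alpha0 (T.flow.g k)) (c.alpha1 (T.flow.g k)) ⊆
    T.space k X (enl n₀ βc (c.alpha0 (T.flow.g k))) (enl n₁ βc (c.alpha1 (T.flow.g k)))
  spaceB_subset : 1 ≤ k → ∀ X, T.spaceB k X ⊆ SB X
  boundE : 1 ≤ k → ∀ X z g φ, 0 ≤ g → g ≤ c.γ →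
    φ ∈ T.space k X (enl n₀ βc (c.alpha0 (T.flow.g k))) (enl n₁ βc (c.alpha1 (T.flow.g k))) →
      ‖T.E k X z g φ‖ ≤ c.E₀ * Real.exp (-((1 + 4 * βc) * c.κ) * (T.sys k).dj X)
  boundR : 1 ≤ k → ∀ X φ, φ ∈ T.space k X (enl n₀ βc (c.alpha0 (T.flow.g k))) (enl n₁ βc (c.alpha1 (T.flow.g k))) →
      ‖T.R k X φ‖ ≤ (T.flow.g k) ^ c.κ₀ * Real.exp (-((1 + 4 * βc) * c.κ) * (T.sys k).dj X)
  boundB : 1 ≤ k → ∀ X φ a, φ ∈ SB X →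
      ‖T.B k X φ a‖ ≤ c.B₀ * Real.exp (-((1 + 4 * βc) * c.κ) * (T.sys k).dj X)

/-- The [I] numbers: radii multiplied by `1 + 2β` (*"U^c_{k+1}(□₀, (1+2β)α₀, (1+2β)α₁)"*, [I] (3.28)/(3.34) p. 277 and
Lemma 4 p. 280). [cite: Balaban1987RG1, Lemma 4 p.280] -/
abbrev instI (T : LFTower P G Φ 𝒢 𝔄) (c : LFConsts) (βc : ℝ) (k : ℕ) (SB : (T.sys k).Dom → Set Φ) : Prop :=
  LFHypImprovedSpace T c βc 2 2 k SB

/-! ## §2. Bookkeeping PROVED -/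

namespace LFHypImprovedSpace

variable {T : LFTower P G Φ 𝒢 𝔄} {c : LFConsts} {βc n₀ n₁ : ℝ} {k : ℕ} {SB : (T.sys k).Dom → Set Φ}

/-- Restriction along the inclusions: the improved assumptions WITH the space clause give the improved assumptions on the
ORIGINAL spaces (`Step.LFHypImproved`, the decay clause alone). [cite: Balaban1988Convergent, §2 p.262] -/
theorem toImproved (h : LFHypImprovedSpace T c βc n₀ n₁ k SB) : LFHypImproved T c βc k where
  boundE hk X z g φ hg0 hgγ hφ := h.boundE hk X z g φ hg0 hgγ (h.space_subset hk X hφ)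
  boundR hk X φ hφ := h.boundR hk X φ (h.space_subset hk X hφ)
  boundB hk X φ a hφ := h.boundB hk X φ a (h.spaceB_subset hk X hφ)

/-- … hence the ordinary E-bound (2.27)(iv) = (I.1.18) when the index becomes old (`β, κ, E₀ ≥ 0`). [cite: Balaban1988Convergent, §2 p.262] -/
theorem toWeak_E (h : LFHypImprovedSpace T c βc n₀ n₁ k SB) (hβ : 0 ≤ βc) (hκ : 0 ≤ c.κ) (hk : 1 ≤ k)
    (X : (T.sys k).Dom) (z : T.Pt k) (g : ℝ) (φ : Φ) (hg0 : 0 ≤ g) (hgγ : g ≤ c.γ)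
    (hφ : φ ∈ T.space k X (c.alpha0 (T.flow.g k)) (c.alpha1 (T.flow.g k))) (hE₀ : 0 ≤ c.E₀) :
    ‖T.E k X z g φ‖ ≤ c.E₀ * Real.exp (-c.κ * (T.sys k).dj X) :=
  h.toImproved.toWeak_E hβ hκ hk X z g φ hg0 hgγ hφ hE₀

/-- … the ordinary 𝐑-bound (2.31) (`β, κ ≥ 0`, `g_k ≥ 0`). [cite: Balaban1988Convergent, (2.31) p.260, §2 p.262] -/
theorem toWeak_R (h : LFHypImprovedSpace T c βc n₀ n₁ k SB) (hβ : 0 ≤ βc) (hκ : 0 ≤ c.κ) (hk : 1 ≤ k)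
    (hg : 0 ≤ T.flow.g k) (X : (T.sys k).Dom) (φ : Φ)
    (hφ : φ ∈ T.space k X (c.alpha0 (T.flow.g k)) (c.alpha1 (T.flow.g k))) :
    ‖T.R k X φ‖ ≤ (T.flow.g k) ^ c.κ₀ * Real.exp (-c.κ * (T.sys k).dj X) :=
  h.toImproved.toWeak_R hβ hκ hk hg X φ hφ

/-- … and the ordinary 𝐁-bound (2.42) (`β, κ, B₀ ≥ 0`). [cite: Balaban1988Convergent, (2.42) p.261, §2 p.262] -/
theorem toWeak_B (h : LFHypImprovedSpace T c βc n₀ n₁ k SB) (hβ : 0 ≤ βc) (hκ : 0 ≤ c.κ) (hk : 1 ≤ k)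
    (hB₀ : 0 ≤ c.B₀) (X : (T.sys k).Dom) (φ : Φ) (a : 𝔄) (hφ : φ ∈ T.spaceB k X) :
    ‖T.B k X φ a‖ ≤ c.B₀ * Real.exp (-c.κ * (T.sys k).dj X) :=
  h.toImproved.toWeak_B hβ hκ hk hB₀ X φ a hφ

/-- At `k = 0` the predicate is vacuous (no terms yet: `ρ₀ = exp[−(1/g₀²)A − E]`), as `Step.LFHypImproved.zero`. [cite: Balaban1988Convergent, §2 p.262] -/
protected theorem zero (T : LFTower P G Φ 𝒢 𝔄) (c : LFConsts) (βc n₀ n₁ : ℝ) (SB : (T.sys 0).Dom → Set Φ) :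
    LFHypImprovedSpace T c βc n₀ n₁ 0 SB where
  space_subset h := absurd h (by omega)
  spaceB_subset h := absurd h (by omega)
  boundE h := absurd h (by omega)
  boundR h := absurd h (by omega)
  boundB h := absurd h (by omega)

/-- ZERO ENLARGEMENT (`n₀ = n₁ = 0`, `SB = Ũ^c_k`): the predicate with the space clause IS the cell's `Step.LFHypImproved`
— the new predicate is a conservative extension of the old one. [cite: Balaban1988Convergent, §2 p.262] -/
theorem iff_improved_of_zero (T : LFTower P G Φ 𝒢 𝔄) (c : LFConsts) (βc : ℝ) (k : ℕ) :
    LFHypImprovedSpace T c βc 0 0 k (T.spaceB k) ↔ LFHypImproved T c βc k := by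
  constructor
  · exact fun h => h.toImproved
  · intro h
    refine ⟨fun _ X => by simp, fun _ X => le_rfl, ?_, ?_, fun hk X φ a hφ => h.boundB hk X φ a hφ⟩
    · intro hk X z g φ hg0 hgγ hφ
      simp only [enl_zero_left] at hφ
      exact h.boundE hk X z g φ hg0 hgγ hφ
    · intro hk X φ hφ
      simp only [enl_zero_left] at hφ
      exact h.boundR hk X φ hφ

/-- A LARGER enlargement is a STRONGER hypothesis: if the abstract spaces `U^c_k(X, ·, ·)` are monotone in their radii
(`hmono` — true for the printed spaces, which are cut out by strict inequalities `< α₀`, `< α₁` on derivatives, [I]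
(1.11)–(1.14); abstract here), `β ≥ 0`, the radii `α_{0,k}, α_{1,k} ≥ 0`, `n₀ ≤ n₀'`, `n₁ ≤ n₁'` and `SB ⊆ SB'`
pointwise, then the predicate with `(n₀', n₁', SB')` implies the one with `(n₀, n₁, SB)`, PROVIDED the smaller
enlargement still contains the old spaces (`hsub`, `hsubB`). [cite: Balaban1988Convergent, §2 p.262] -/
theorem anti {n₀' n₁' : ℝ} {SB' : (T.sys k).Dom → Set Φ} (h : LFHypImprovedSpace T c βc n₀' n₁' k SB')
    (hmono : ∀ (X : (T.sys k).Dom) (a b a' b' : ℝ), a ≤ a' → b ≤ b' → T.space k X a b ⊆ T.space k X a' b')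
    (hβ : 0 ≤ βc) (hα0 : 0 ≤ c.alpha0 (T.flow.g k)) (hα1 : 0 ≤ c.alpha1 (T.flow.g k))
    (h0 : n₀ ≤ n₀') (h1 : n₁ ≤ n₁') (hSB : ∀ X, SB X ⊆ SB' X)
    (hsub : 1 ≤ k → ∀ X, T.space k X (c.alpha0 (T.flow.g k)) (c.alpha1 (T.flow.g k)) ⊆
      T.space k X (enl n₀ βc (c.alpha0 (T.flow.g k))) (enl n₁ βc (c.alpha1 (T.flow.g k))))
    (hsubB : 1 ≤ k → ∀ X, T.spaceB k X ⊆ SB X) :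
    LFHypImprovedSpace T c βc n₀ n₁ k SB where
  space_subset := hsub
  spaceB_subset := hsubB
  boundE hk X z g φ hg0 hgγ hφ :=
    h.boundE hk X z g φ hg0 hgγ (hmono X _ _ _ _ (enl_mono h0 hβ hα0) (enl_mono h1 hβ hα1) hφ)
  boundR hk X φ hφ := h.boundR hk X φ (hmono X _ _ _ _ (enl_mono h0 hβ hα0) (enl_mono h1 hβ hα1) hφ)
  boundB hk X φ a hφ := h.boundB hk X φ a (hSB X hφ)

/-- With monotone abstract spaces and non-negative `n₀, n₁, β, α_{0,k}, α_{1,k}`, the inclusion clause `space_subset`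
holds automatically (so only the bounds carry content). [cite: Balaban1988Convergent, §2 p.262] -/
theorem space_subset_of_mono (T : LFTower P G Φ 𝒢 𝔄) (c : LFConsts) {βc n₀ n₁ : ℝ} (k : ℕ)
    (hmono : ∀ (X : (T.sys k).Dom) (a b a' b' : ℝ), a ≤ a' → b ≤ b' → T.space k X a b ⊆ T.space k X a' b')
    (hn₀ : 0 ≤ n₀) (hn₁ : 0 ≤ n₁) (hβ : 0 ≤ βc) (hα0 : 0 ≤ c.alpha0 (T.flow.g k)) (hα1 : 0 ≤ c.alpha1 (T.flow.g k))
    (X : (T.sys k).Dom) :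
    T.space k X (c.alpha0 (T.flow.g k)) (c.alpha1 (T.flow.g k)) ⊆
      T.space k X (enl n₀ βc (c.alpha0 (T.flow.g k))) (enl n₁ βc (c.alpha1 (T.flow.g k))) :=
  hmono X _ _ _ _ (le_enl hn₀ hβ hα0) (le_enl hn₁ hβ hα1)

/-- The [I] instance restricts to `Step.LFHypImproved` like any other. [cite: Balaban1987RG1, Lemma 4 p.280] -/
theorem instI_toImproved {SB : (T.sys k).Dom → Set Φ} (h : instI T c βc k SB) : LFHypImproved T c βc k :=
  LFHypImprovedSpace.toImproved h

end LFHypImprovedSpace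

end Literature.MathematicalPhysics.QuantumFieldTheory.Balaban1983to89.B14.Def2ImprovedSpace

end
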